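import Literature.MathematicalPhysics.QuantumFieldTheory.Balaban1983to89.B9Eq342GreenPrimeTowerSupBoundDecayCosh
import Literature.MathematicalPhysics.QuantumFieldTheory.Balaban1983to89.B9Eq324PenaltyBlockLocal

/-!
# `Balaban1983to89.B9Eq342GreenPrimeTowerSupBoundDecayPenalty` — T. Bałaban, *Propagators for lattice gauge theories in a background field*, Commun. Math.
# Phys. **99** (1985) 389–434 [Balaban1985BackgroundPropagators] Thm 3.1 (3.42) p. 397 with (3.24) p. 394 and (3.19) p. 393: **THE TOWER ROW OF (3.42) FOR PRINT's
# `G′_k(U)` WITH THE PENALTY LETTER (D-P)k AND THE ONE-BLOCK MASSES INHABITED — `‖(G′_k(U)f)(x₀)‖ ≤ ((1 + |a′|C_E)·2e^{1∕2}·Σ_{l<k}2^{l+1} + √(3^d·2^k)·√(2e^{1∕2}·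
# K_d(1∕√(4d+1) − 2κ′))·C_E)·K_d(κ′)·sup|f|` for EVERY `f`, EVERY height, EVERY `L`, EVERY volume, the constant a function of `(d, a′, C_E, κ′, k)` ALONE
# (the weights `c₀`, `c₁` CANCEL) — modulo the transporter letters ((T) for `U`, `hRlev` for the level averages `Ū^j`, as ne9-leaf-03's (D) displays them) and
# the ONE open letter (D-E)k (`C_E`, `κ`: the big-block `L²` decay of `G′_k(U)`)** — the tower analogue of `B9Eq342GreenPrimeSupBoundDecayClosed` minus
# (D-E) (storey (D) of the NE9 owner's sup-norm programme, plan v10 §5; `t4/b2b-balaban-t4-ne9-p1/g90/STOREY-D-ASSEMBLY.md` §3)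

statement-level skeleton of published theorems with citation tags; proofs where landed; nothing here is a claim about the Yang–Mills mass gap

CITATION HEADER (lean-in-tree rule).  Audit cell `pub-balaban`, sub-cell `t4`, BINDER row NE9; filed by the NE9 BINDER-row OWNER lineage
`b2b-balaban-t4-ne9-p1` (gen 91).  Composed BY NAME: this lineage's `B9Eq342GreenPrimeTowerSupBoundDecayCosh.norm_GpOfUk_apply_le_rowSum_heightFree`
(the height-free tower row, letters (D-P)k ∕ masses ∕ (D-E)k displayed) with ne9-leaf-03 g69∕g70's `B9Eq324PenaltyBlockLocal` §2
(`norm_laplacePrimeAk_sub_covLaplace_apply_le_block_diagonal`: (D-P)k with `p₂ = |a′|∕√c₁` on the diagonal `c₀(L^{n+1})^d = c₁`) and §3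
(`norm_block_le_sqrt_mul_tower`: `‖P_yf‖ ≤ √(c₀(L^{n+1})^d)·F = √c₁·F`), junction `B9Eq342GreenPrimeTowerSupBoundDecay.bigBlock_eq_iff`.  Sources READ
first-hand (`paper:balaban1985-cmp99-background-propagators`): p. 397 Thm 3.1, p. 394 (3.24), p. 393 (3.19).  NOTHING of the random-walk proof reproduced.

WHAT IS PROVED (sorry-free; proof lane — no `def`; [folklore] bookkeeping over named letters).
* (inline, no declaration) the (K1) big-block family in ne9-leaf-03's fibre-predicate currency, from the `Π`-currency by `bigBlock_eq_iff` + `if_congr`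
  (the same two lines are the landed `Beta.RemainderHasMajGreenPrimeTowerDecayCoshClosed.hPS_fibre`, beta-an4; not restated here);
* **`norm_GpOfUk_apply_le_rowSum_heightFree_penalty`**: the displayed form with `p₂ := |a′|∕√c₁`, `μ := c₁` discharged;
* **`norm_GpOfUk_apply_le_rowSum_heightFree_penalty'`**: the same with the weights cancelled — constant in `(d, a′, C_E, κ′, k)` only;
* **`…_penalty_unitary`**: (T) for `U` inhabited on the chain's class (unitary `U`, `*`-trace, compatible fibre norm); `hRlev` stays displayed (the level
  averages' transporters, exactly as in `B9Eq324PenaltyBlockLocal` §2 and `B9Eq365QGGQLowerVariationalWindowTower`'s `hLb`).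
HONEST SCOPE.  VALUE row only; (D-E)k DISPLAYED, NOT inhabited; no ∇-row, no Hölder rows (3.40), no (3.43)–(3.47), no random walk; «NE9 ⇐ the named
binders»; NE9 NOT PRINTED ∕ NOT PROVED; row WALLED ON A MODEL (O-NE9-1; NEEDS-COORDINATOR #5 UNRULED); spine PROVED 0∕9; rung (B)+1 on a finite T⁴ — NOT
infinite volume, NOT mass gap, NOT BetaPertH, NOT Clay.  HONEST DEPENDENCY: continuum YM on T⁴ ⇐ BetaPertH ∧ nine spine estimates (0/9 proved); BetaPertH ⇐
(D1) ∧ (D4) ∧ CAP+tail; G-an2-4 gates asym, D1 and NE2/3/4.  NEW file; nothing modified.  Net new unproved facts: 0.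
-/

noncomputable section

open scoped InnerProductSpace ComplexConjugate BigOperators

namespace Literature.MathematicalPhysics.QuantumFieldTheory.Balaban1983to89.B9Eq342GreenPrimeTowerSupBoundDecayPenalty

open B4Sect5Torus (TSite tdist)
open B4Sect5Proof (latticeConst)
open B9SectCLatticeCarrier (Bond)
open B9Eq311L2Pairing (WL2)
open B11Eq103H1Complex (SiteL2K covLaplaceSiteK)
open B9Eq310HessianOperator (adTransportW)
open B9Eq319QprimeTorus (fineP blockCoord)
open B9Eq315QTower (towerP UlevOf)
open B9Eq316TowerFlatIsOneStep (towerP_eq_fineP_pow siteCast)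
open B9Eq324DeltaPrimeATower (laplacePrimeAk GpOfUk)
open B9Eq342GreenPrimeSupBound (norm_adTransportW_eq norm_adTransportW_inv_eq)
open B9Eq342GreenPrimeTowerSupBoundDecay (bigBlock_eq_iff)
open B9Eq342GreenPrimeTowerSupBoundDecayCosh (norm_GpOfUk_apply_le_rowSum_heightFree)
open B9Eq324PenaltyBlockLocal (norm_laplacePrimeAk_sub_covLaplace_apply_le_block_diagonal norm_block_le_sqrt_mul_tower)

variable {d : ℕ} (L : ℕ) [NeZero L] (m : Fin d → ℕ) [∀ i, NeZero (m i)] (n : ℕ)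
  {𝔸 : Type*} [NormedRing 𝔸] [NormedAlgebra ℂ 𝔸] [CompleteSpace 𝔸]
  {W : Type*} [NormedAddCommGroup W] [InnerProductSpace ℂ W] [FiniteDimensional ℂ W] (φ : W ≃ₗ[ℂ] 𝔸) {c₀ : ℝ} [Fact (0 < c₀)]
  (η : ℝ) (U : Bond d (towerP L m (n + 1)) → 𝔸ˣ) {c₁ : ℝ} [Fact (0 < c₁)] (a' : ℝ)
  (hpos' : ∀ x : SiteL2K ℂ d (towerP L m (n + 1)) c₀ W, x ≠ 0 → 0 < RCLike.re ⟪x, laplacePrimeAk L m n φ η U a' (c₁ := c₁) x⟫_ℂ)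

/-- **THE HEIGHT-FREE TOWER ROW WITH (D-P)k AND THE MASSES INHABITED** (`1 ≤ d ≤ k`; the diagonal `η⁻¹ = L^{n+1}`, `c₀(L^{n+1})^d = c₁`; rates
`0 < κ′ ≤ κ`, `2κ′ < 1∕√(4d+1)`; contractive transporters of `U` (T) and of its level averages `Ū^j` (`hRlev`); (D-E)k displayed): for EVERY `f` with
`‖f(x)‖ ≤ F`,
`‖(G′_k(U)f)(x₀)‖ ≤ ((1 + (|a′|∕√c₁)·C_E·√c₁)·2e^{1∕2}·Σ_{l<k}2^{l+1} + √(3^d∕c₁·2^k)·√(2e^{1∕2}·K_d(1∕√(4d+1) − 2κ′))·C_E·√c₁)·K_d(κ′)·F`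
— `norm_GpOfUk_apply_le_rowSum_heightFree` with `p₂ := |a′|∕√c₁` (ne9-leaf-03's (D) §2) and `μ := c₁` (ibid. §3).
[cite: Balaban1985BackgroundPropagators, Thm 3.1 (3.42) p.397, (3.24) p.394, (3.19) p.393, (3.49) p.399] -/
theorem norm_GpOfUk_apply_le_rowSum_heightFree_penalty (hd : 1 ≤ d)
    (hR : ∀ b w, ‖adTransportW φ U b w‖ ≤ ‖w‖) (hS : ∀ b w, ‖adTransportW φ (fun b => (U b)⁻¹) b w‖ ≤ ‖w‖)
    (hRlev : ∀ j b w, ‖adTransportW φ (UlevOf L m (n + 1) U j) b w‖ ≤ ‖w‖)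
    {PS : TSite d m → SiteL2K ℂ d (towerP L m (n + 1)) c₀ W →L[ℂ] SiteL2K ℂ d (towerP L m (n + 1)) c₀ W}
    (hPS : ∀ (y : TSite d m) (g : SiteL2K ℂ d (towerP L m (n + 1)) c₀ W) (x : TSite d (towerP L m (n + 1))),
      WL2.equiv ℂ (fun _ : TSite d (towerP L m (n + 1)) => c₀) W (PS y g) x =
        if blockCoord (L ^ (n + 1)) m (siteCast (towerP_eq_fineP_pow L m (n + 1)) x) = y then
          WL2.equiv ℂ (fun _ : TSite d (towerP L m (n + 1)) => c₀) W g x else 0)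
    {CE κ κ' : ℝ} (hCE : 0 ≤ CE) (hκ' : 0 < κ') (hκ : κ' ≤ κ) (h2κ : 2 * κ' < Real.sqrt (1 / (4 * d + 1)))
    (hηN : η⁻¹ = (L : ℝ) ^ (n + 1)) (hdiag : c₀ * ((L : ℝ) ^ (n + 1)) ^ d = c₁) {k : ℕ} (hk : d ≤ k)
    (hdec : ∀ v y : TSite d m, ‖PS y ∘L LinearMap.toContinuousLinearMap (GpOfUk L m n φ η U a' hpos') ∘L PS v‖ ≤
      CE * Real.exp (-(κ * tdist m v y)))
    (x₀ : TSite d (towerP L m (n + 1))) (f : SiteL2K ℂ d (towerP L m (n + 1)) c₀ W) {F : ℝ} (hF : ∀ y, ‖WL2.equiv ℂ _ W f y‖ ≤ F) :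
    ‖WL2.equiv ℂ _ W (GpOfUk L m n φ η U a' hpos' f) x₀‖ ≤
      ((1 + |a'| * (Real.sqrt c₁)⁻¹ * CE * Real.sqrt c₁) * (Real.exp (1 / 2) * 2) * (∑ l ∈ Finset.range k, (2 : ℝ) ^ (l + 1)) +
        Real.sqrt (3 ^ d / c₁ * 2 ^ k) * Real.sqrt ((Real.exp (1 / 2) * 2) * latticeConst d (Real.sqrt (1 / (4 * d + 1)) - 2 * κ')) *
          CE * Real.sqrt c₁) * latticeConst d κ' * F := by
  have hF0 : 0 ≤ F := (norm_nonneg _).trans (hF x₀)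
  have hPS' : ∀ (y : TSite d m) (g : SiteL2K ℂ d (towerP L m (n + 1)) c₀ W) (x : TSite d (towerP L m (n + 1))),
      WL2.equiv ℂ (fun _ : TSite d (towerP L m (n + 1)) => c₀) W (PS y g) x =
        if (∀ i, (x i : ℕ) / L ^ (n + 1) = (y i : ℕ)) then WL2.equiv ℂ (fun _ : TSite d (towerP L m (n + 1)) => c₀) W g x else 0 :=
    fun y g x => by rw [hPS]; exact if_congr (bigBlock_eq_iff L m n x y) rfl rfl
  -- (D-P)k with `p₂ = |a′|∕√c₁`
  have hP : ∀ (v : SiteL2K ℂ d (towerP L m (n + 1)) c₀ W) (x : TSite d (towerP L m (n + 1))),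
      ‖WL2.equiv ℂ _ W (laplacePrimeAk L m n φ η U a' (c₁ := c₁) v -
        covLaplaceSiteK ((η : ℂ))⁻¹ (adTransportW φ U) (adTransportW φ fun b => (U b)⁻¹) v) x‖ ≤
        |a'| * (Real.sqrt c₁)⁻¹ * ‖PS (blockCoord (L ^ (n + 1)) m (siteCast (towerP_eq_fineP_pow L m (n + 1)) x)) v‖ := fun v x =>
    norm_laplacePrimeAk_sub_covLaplace_apply_le_block_diagonal L m n φ U (hP := hPS') (hRlev := hRlev) hdiag η a' v x _
      ((bigBlock_eq_iff L m n x _).1 rfl)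
  -- the masses `μ = c₁`
  have hμ : ∀ v, ‖PS v f‖ ≤ Real.sqrt c₁ * F := fun v => by
    have h := norm_block_le_sqrt_mul_tower L m n hPS' v f hF0 (fun x _ => hF x)
    rwa [hdiag] at h
  exact norm_GpOfUk_apply_le_rowSum_heightFree L m n φ η U a' hpos' (c₁ := c₁) hd hR hS hPS (by positivity) hCE hκ' hκ h2κ hηN hdiag hk hP
    hdec x₀ f hF hμ

/-- **… WITH THE WEIGHTS CANCELLED**: `‖(G′_k(U)f)(x₀)‖ ≤ ((1 + |a′|C_E)·2e^{1∕2}·Σ_{l<k}2^{l+1} + √(3^d·2^k)·√(2e^{1∕2}·K_d(1∕√(4d+1) − 2κ′))·C_E)·K_d(κ′)·F` — the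
constant is a function of `(d, a′, C_E, κ′, k)` ALONE: no `n`, `L`, `m`, `η`, `c₀`, `c₁`. [cite: Balaban1985BackgroundPropagators, Thm 3.1 (3.42) p.397 «B₀ dependent on d only»] -/
theorem norm_GpOfUk_apply_le_rowSum_heightFree_penalty' (hd : 1 ≤ d)
    (hR : ∀ b w, ‖adTransportW φ U b w‖ ≤ ‖w‖) (hS : ∀ b w, ‖adTransportW φ (fun b => (U b)⁻¹) b w‖ ≤ ‖w‖)
    (hRlev : ∀ j b w, ‖adTransportW φ (UlevOf L m (n + 1) U j) b w‖ ≤ ‖w‖)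
    {PS : TSite d m → SiteL2K ℂ d (towerP L m (n + 1)) c₀ W →L[ℂ] SiteL2K ℂ d (towerP L m (n + 1)) c₀ W}
    (hPS : ∀ (y : TSite d m) (g : SiteL2K ℂ d (towerP L m (n + 1)) c₀ W) (x : TSite d (towerP L m (n + 1))),
      WL2.equiv ℂ (fun _ : TSite d (towerP L m (n + 1)) => c₀) W (PS y g) x =
        if blockCoord (L ^ (n + 1)) m (siteCast (towerP_eq_fineP_pow L m (n + 1)) x) = y then
          WL2.equiv ℂ (fun _ : TSite d (towerP L m (n + 1)) => c₀) W g x else 0)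
    {CE κ κ' : ℝ} (hCE : 0 ≤ CE) (hκ' : 0 < κ') (hκ : κ' ≤ κ) (h2κ : 2 * κ' < Real.sqrt (1 / (4 * d + 1)))
    (hηN : η⁻¹ = (L : ℝ) ^ (n + 1)) (hdiag : c₀ * ((L : ℝ) ^ (n + 1)) ^ d = c₁) {k : ℕ} (hk : d ≤ k)
    (hdec : ∀ v y : TSite d m, ‖PS y ∘L LinearMap.toContinuousLinearMap (GpOfUk L m n φ η U a' hpos') ∘L PS v‖ ≤
      CE * Real.exp (-(κ * tdist m v y)))
    (x₀ : TSite d (towerP L m (n + 1))) (f : SiteL2K ℂ d (towerP L m (n + 1)) c₀ W) {F : ℝ} (hF : ∀ y, ‖WL2.equiv ℂ _ W f y‖ ≤ F) :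
    ‖WL2.equiv ℂ _ W (GpOfUk L m n φ η U a' hpos' f) x₀‖ ≤
      ((1 + |a'| * CE) * (Real.exp (1 / 2) * 2) * (∑ l ∈ Finset.range k, (2 : ℝ) ^ (l + 1)) +
        Real.sqrt (3 ^ d * 2 ^ k) * Real.sqrt ((Real.exp (1 / 2) * 2) * latticeConst d (Real.sqrt (1 / (4 * d + 1)) - 2 * κ')) * CE) *
        latticeConst d κ' * F := by
  have hc₁ : 0 < c₁ := Fact.out
  have h := norm_GpOfUk_apply_le_rowSum_heightFree_penalty L m n φ η U a' hpos' (c₁ := c₁) hd hR hS hRlev hPS hCE hκ' hκ h2κ hηN hdiag hk hdec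
    x₀ f hF
  have hs : Real.sqrt c₁ ≠ 0 := (Real.sqrt_pos.2 hc₁).ne'
  have e1 : |a'| * (Real.sqrt c₁)⁻¹ * CE * Real.sqrt c₁ = |a'| * CE := by field_simp
  have e2 : Real.sqrt (3 ^ d / c₁ * 2 ^ k) * Real.sqrt ((Real.exp (1 / 2) * 2) * latticeConst d (Real.sqrt (1 / (4 * d + 1)) - 2 * κ')) *
      CE * Real.sqrt c₁ =
      Real.sqrt (3 ^ d * 2 ^ k) * Real.sqrt ((Real.exp (1 / 2) * 2) * latticeConst d (Real.sqrt (1 / (4 * d + 1)) - 2 * κ')) * CE := by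
    have e3 : Real.sqrt (3 ^ d / c₁ * 2 ^ k) * Real.sqrt c₁ = Real.sqrt (3 ^ d * 2 ^ k) := by
      rw [← Real.sqrt_mul (by positivity)]
      congr 1
      field_simp
    calc _ = (Real.sqrt (3 ^ d / c₁ * 2 ^ k) * Real.sqrt c₁) *
          Real.sqrt ((Real.exp (1 / 2) * 2) * latticeConst d (Real.sqrt (1 / (4 * d + 1)) - 2 * κ')) * CE := by ring
      _ = _ := by rw [e3]
  rw [e1, e2] at h
  exact h

/-- **… ON THE CHAIN's CLASS, (T) FOR `U` INHABITED** (`[StarRing 𝔸]`; unitary `U`, `*`-trace, compatible fibre norm); `hRlev` and (D-E)k stay displayed.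
[cite: Balaban1985BackgroundPropagators, Thm 3.1 (3.42) p.397, (3.39) p.397] -/
theorem norm_GpOfUk_apply_le_rowSum_heightFree_penalty_unitary [StarRing 𝔸] (hd : 1 ≤ d) (τ : 𝔸 →ₗ[ℂ] ℂ)
    (hτ₂ : ∀ X Y : 𝔸, τ (X * Y) = τ (Y * X)) (hU : ∀ b, star (U b : 𝔸) = ((U b)⁻¹ : 𝔸ˣ))
    (hφ : ∀ X Y : 𝔸, ⟪φ.symm X, φ.symm Y⟫_ℂ = τ (star X * Y))
    (hRlev : ∀ j b w, ‖adTransportW φ (UlevOf L m (n + 1) U j) b w‖ ≤ ‖w‖)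
    {PS : TSite d m → SiteL2K ℂ d (towerP L m (n + 1)) c₀ W →L[ℂ] SiteL2K ℂ d (towerP L m (n + 1)) c₀ W}
    (hPS : ∀ (y : TSite d m) (g : SiteL2K ℂ d (towerP L m (n + 1)) c₀ W) (x : TSite d (towerP L m (n + 1))),
      WL2.equiv ℂ (fun _ : TSite d (towerP L m (n + 1)) => c₀) W (PS y g) x =
        if blockCoord (L ^ (n + 1)) m (siteCast (towerP_eq_fineP_pow L m (n + 1)) x) = y then
          WL2.equiv ℂ (fun _ : TSite d (towerP L m (n + 1)) => c₀) W g x else 0)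
    {CE κ κ' : ℝ} (hCE : 0 ≤ CE) (hκ' : 0 < κ') (hκ : κ' ≤ κ) (h2κ : 2 * κ' < Real.sqrt (1 / (4 * d + 1)))
    (hηN : η⁻¹ = (L : ℝ) ^ (n + 1)) (hdiag : c₀ * ((L : ℝ) ^ (n + 1)) ^ d = c₁) {k : ℕ} (hk : d ≤ k)
    (hdec : ∀ v y : TSite d m, ‖PS y ∘L LinearMap.toContinuousLinearMap (GpOfUk L m n φ η U a' hpos') ∘L PS v‖ ≤
      CE * Real.exp (-(κ * tdist m v y)))
    (x₀ : TSite d (towerP L m (n + 1))) (f : SiteL2K ℂ d (towerP L m (n + 1)) c₀ W) {F : ℝ} (hF : ∀ y, ‖WL2.equiv ℂ _ W f y‖ ≤ F) :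
    ‖WL2.equiv ℂ _ W (GpOfUk L m n φ η U a' hpos' f) x₀‖ ≤
      ((1 + |a'| * CE) * (Real.exp (1 / 2) * 2) * (∑ l ∈ Finset.range k, (2 : ℝ) ^ (l + 1)) +
        Real.sqrt (3 ^ d * 2 ^ k) * Real.sqrt ((Real.exp (1 / 2) * 2) * latticeConst d (Real.sqrt (1 / (4 * d + 1)) - 2 * κ')) * CE) *
        latticeConst d κ' * F :=
  norm_GpOfUk_apply_le_rowSum_heightFree_penalty' L m n φ η U a' hpos' hd (fun b w => (norm_adTransportW_eq φ U τ hτ₂ hU hφ b w).le)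
    (fun b w => (norm_adTransportW_inv_eq φ U τ hτ₂ hU hφ b w).le) hRlev hPS hCE hκ' hκ h2κ hηN hdiag hk hdec x₀ f hF

end Literature.MathematicalPhysics.QuantumFieldTheory.Balaban1983to89.B9Eq342GreenPrimeTowerSupBoundDecayPenalty

end
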